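import Summits.BirchSwinnertonDyer.Rank2.CertifiedPartnerTypeATorsion
import Literature.NumberTheory.EllipticCurves.PAdicGrossZagierConstantTermProofs
import HarnessLib

/-!
# Certified partners of Greenberg type A, IV: every type-A curve has a partner; `stub_partnerCF` in full (cell `bsd-rank2`)

Cell `bsd-rank2` (D-0036), seat `bsd-rank2-lit` GEN 18, stub `stub_partnerCF` of the E1M line `cfsplit` (crux
`DepletedLambdaLawAtTwoMod` of route `EisensteinDepletionAtTwo`, planner p2). TYPE A («ramified at `2`, not odd»):

* **The type-A invariant** (`exists_eq_delta_of_typeA`). For `W` globally minimal, good ordinary at `2`, with a rational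
  point of order `2` of abscissa `x` RAMIFIED at `2` and NOT ODD: `x = n/4` with `n` odd (the denominator divides `4n³`,
  and `den = 1, 2` contradict `v₂(x) < 0`, resp. the parity of `b₂`), and with `δ = b₂² − 8b₂x − 48x² − 32b₄` one has
  `δ = 256·D` for an ODD POSITIVE integer `D`: indeed `256·Δ_min = δ·(3n² + 2b₂n + 8b₄)²` (from
  `4Δ = δ(6x²+b₂x+b₄)²`) with the bracket odd and `Δ_min` odd, and `δ = (8r + 4x + b₂)² ≥ 0` for the real root `r < x`.
* **Existence** (`exists_partnerA`): `D` is not a square (uniqueness of the rational `2`-torsion), and the partner is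
  `W′_i` of `Rank2/CertifiedPartnerTypeAModelOne.lean` (`D = 4i+1`) or `…ModelThree.lean` (`D = 4i+3`), with
  `Δ(W)·Δ(W′_i) = (216·D·(6x²+b₂x+b₄)/… )²`-type identities.
* **`exists_partnerCF_typeA`** = the registered conclusion of `stub_partnerCF` for type-A input, and
  **`exists_partnerCF`** = `stub_partnerCF` VERBATIM (type A here, type B from `Rank2/CertifiedPartnerTypeB.lean`).

PARTITION: none — r_an ≥ 2, summit axis S0; TWIN (D-0056): n/a. B1: explicit-model algebra; no `L`-function, no Selmer
group, no S0 motion. No named fact, no `sorry`.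
-/

noncomputable section

namespace Summit.BirchSwinnertonDyer.Rank2

open _root_.WeierstrassCurve
open Literature.NumberTheory.EllipticCurves
open Literature.NumberTheory.EllipticCurves.Greenberg1999

section PartnerTypeA

variable (W : WeierstrassCurve ℚ) [W.IsElliptic] [W.IsGloballyMinimal]

/-- **The type-A invariant.** See the module docstring. [folklore] -/
theorem exists_eq_delta_of_typeA (hord : IsOrdinaryAt W 2) {x : ℚ} (hx : HasRationalTwoTorsionX W x)
    (hram : TwoTorsionRamifiedAtTwo x) (hnotodd : ¬ TwoTorsionOdd W x) :
    ∃ D : ℤ, D % 2 = 1 ∧ 0 < D ∧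
      (D : ℚ) * 256 = W.b₂ ^ 2 - 8 * W.b₂ * x - 48 * x ^ 2 - 32 * W.b₄ := by
  -- the integral model, parities
  set M : WeierstrassCurve ℤ := integralModelInt W with hM
  have hWM : M.map (Int.castRingHom ℚ) = W := map_integralModelInt W
  have hodd2 : Odd (W.frobeniusTrace 2) :=
    Int.not_even_iff_odd.mp fun h ↦ hord.2 (by exact_mod_cast even_iff_two_dvd.mp h)
  have ha₁ : Odd M.a₁ :=
    odd_a₁_of_hasGoodReductionAtPrime_two_of_odd_frobeniusTrace_two W hord.1 hodd2
  have hb₂odd : Odd M.b₂ := by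
    rw [WeierstrassCurve.b₂]
    exact ha₁.pow.add_even ⟨2 * M.a₂, by ring⟩
  have hΔodd : Odd M.Δ := by
    have h := W.not_dvd_minimalDiscriminantInt_of_hasGoodReductionAtPrime 2 hord.1
    rw [Int.odd_iff]
    have := Int.emod_two_eq_zero_or_one M.Δ
    rcases this with h0 | h1
    · exact absurd (Int.dvd_of_emod_eq_zero (by exact_mod_cast h0)) (by exact_mod_cast h)
    · exact h1
  have hΔW : W.Δ = (M.Δ : ℚ) := (cast_minimalDiscriminantInt W).symm
  have hb₂ : W.b₂ = (M.b₂ : ℚ) := by rw [← hWM, map_b₂]; simp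
  have hb₄ : W.b₄ = (M.b₄ : ℚ) := by rw [← hWM, map_b₄]; simp
  have hb₆ : W.b₆ = (M.b₆ : ℚ) := by rw [← hWM, map_b₆]; simp
  -- the abscissa `x = n/m`, the cubic relation over `ℤ`, and `m = 4`
  obtain ⟨y, hy, h2⟩ := hx
  have hcub := fourXCubed_add_eq_zero_of_twoTorsion hy h2
  set n : ℤ := x.num with hn
  set m : ℕ := x.den with hm
  have hm0 : (m : ℚ) ≠ 0 := by exact_mod_cast x.den_nz
  have hxm : x * m = n := Rat.mul_den_eq_num x
  have hZ : 4 * n ^ 3 + M.b₂ * n ^ 2 * m + 2 * M.b₄ * n * m ^ 2 + M.b₆ * m ^ 3 = 0 := by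
    have key : ((4 * n ^ 3 + M.b₂ * n ^ 2 * m + 2 * M.b₄ * n * m ^ 2 + M.b₆ * m ^ 3 : ℤ) : ℚ) = 0 := by
      push_cast
      rw [← hxm]
      rw [hb₂, hb₄, hb₆] at hcub
      linear_combination (m : ℚ) ^ 3 * hcub
    exact_mod_cast key
  have hcop : IsCoprime n (m : ℤ) := Int.isCoprime_iff_gcd_eq_one.mpr (by
    show n.natAbs.gcd (m : ℤ).natAbs = 1
    rw [Int.natAbs_natCast]
    exact x.reduced)
  have hm4 : (m : ℤ) ∣ 4 := by
    have hdvd : (m : ℤ) ∣ 4 * n ^ 3 :=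
      ⟨-(M.b₂ * n ^ 2 + 2 * M.b₄ * n * m + M.b₆ * m ^ 2), by linear_combination hZ⟩
    exact (hcop.symm.pow_right (n := 3)).dvd_of_dvd_mul_left (by rwa [mul_comm] at hdvd)
  have hm4' : m ∣ 4 := by exact_mod_cast hm4
  have hmle : m ≤ 4 := Nat.le_of_dvd (by norm_num) hm4'
  have hmpos : 0 < m := x.den_pos
  -- `v₂(x) < 0` unfolded
  have hv : padicValRat 2 x < 0 := hram
  rw [padicValRat] at hv
  haveI : Fact (Nat.Prime 2) := ⟨Nat.prime_two⟩
  have hm_eq : m = 4 := by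
    interval_cases m
    · -- `m = 1`: `x` is an integer, `v₂(x) ≥ 0`
      exfalso
      have : padicValNat 2 x.den = 0 := by rw [← hm]; simp
      rw [this] at hv
      omega
    · -- `m = 2`: `b₂ n²` would be even with `b₂` odd, so `2 ∣ n`, contradicting `gcd(n, 2) = 1`
      exfalso
      have hZ' := hZ
      push_cast at hZ'
      have h' : M.b₂ * n ^ 2 = 2 * (-(n ^ 3 + 2 * M.b₄ * n + 2 * M.b₆)) := by
        have h'' : (M.b₂ * n ^ 2) * 2 = (2 * (-(n ^ 3 + 2 * M.b₄ * n + 2 * M.b₆))) * 2 := by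
          linear_combination hZ'
        exact mul_right_cancel₀ two_ne_zero h''
      have h2 : (2 : ℤ) ∣ M.b₂ * n ^ 2 := ⟨_, h'⟩
      have hn2 : (2 : ℤ) ∣ n := by
        rcases Int.prime_two.dvd_or_dvd h2 with h | h
        · exact absurd h (Int.two_dvd_ne_zero.mpr (Int.odd_iff.mp hb₂odd))
        · exact Int.prime_two.dvd_of_dvd_pow h
      have hc1 := Int.isCoprime_iff_gcd_eq_one.mp hcop
      simp only [Nat.cast_ofNat] at hc1
      have hg : (2 : ℤ) ∣ ((Int.gcd n 2 : ℕ) : ℤ) := Int.dvd_coe_gcd hn2 (dvd_refl _)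
      rw [hc1] at hg
      norm_num at hg
    · exfalso; norm_num at hm4'
    · rfl
  -- with `m = 4`: `n` odd, `x = n/4`
  have hn2 : ¬ (2 : ℤ) ∣ n := by
    intro h
    have hc1 := Int.isCoprime_iff_gcd_eq_one.mp hcop
    rw [hm_eq] at hc1
    simp only [Nat.cast_ofNat] at hc1
    have hg : (2 : ℤ) ∣ ((Int.gcd n 4 : ℕ) : ℤ) := Int.dvd_coe_gcd h (by norm_num)
    rw [hc1] at hg
    norm_num at hg
  have hnodd : Odd n := Int.odd_iff.mpr (Int.two_dvd_ne_zero.mp hn2)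
  have hx4 : x = (n : ℚ) / 4 := by
    have := Rat.num_div_den x
    rw [← hn, ← hm, hm_eq] at this
    exact_mod_cast this.symm
  -- `256 Δ = D_A · u²` with `u` odd
  set DA : ℤ := M.b₂ ^ 2 - 2 * M.b₂ * n - 3 * n ^ 2 - 32 * M.b₄ with hDA
  set u : ℤ := 3 * n ^ 2 + 2 * M.b₂ * n + 8 * M.b₄ with hu
  have h4 := four_mul_Δ_eq_of_twoDivision_root W hcub
  have hkey : 256 * M.Δ = DA * u ^ 2 := by
    have key : (256 : ℚ) * W.Δ = ((DA * u ^ 2 : ℤ) : ℚ) := by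
      rw [hDA, hu]; push_cast
      rw [hx4, hb₂, hb₄] at h4
      linear_combination 64 * h4
    rw [hΔW] at key
    exact_mod_cast key
  have huodd : Odd u := by
    rw [hu, show (3 * n ^ 2 + 2 * M.b₂ * n + 8 * M.b₄ : ℤ) = 3 * n ^ 2 + 2 * (M.b₂ * n + 4 * M.b₄) by ring]
    have h3 : Odd (3 * n ^ 2 : ℤ) := (by decide : Odd (3 : ℤ)).mul hnodd.pow
    exact h3.add_even (even_two_mul _)
  obtain ⟨k, hk⟩ := huodd
  have hcopu : IsCoprime u (2 : ℤ) := ⟨1, -k, by rw [hk]; ring⟩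
  have hcop2 : IsCoprime (u ^ 2) ((2 : ℤ) ^ 8) := hcopu.pow
  have hudvd : u ^ 2 ∣ M.Δ := by
    have : u ^ 2 ∣ (2 : ℤ) ^ 8 * M.Δ := ⟨DA, by linear_combination hkey⟩
    exact hcop2.dvd_of_dvd_mul_left this
  obtain ⟨X, hX⟩ := hudvd
  have hu0 : u ≠ 0 := by rintro h0; rw [h0] at hk; omega
  have hDA256 : DA = 256 * X := by
    have : DA * u ^ 2 = 256 * X * u ^ 2 := by rw [← hkey, hX]; ring
    exact mul_right_cancel₀ (pow_ne_zero 2 hu0) this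
  have hXodd : Odd X := by
    rw [hX] at hΔodd
    exact (Int.odd_mul.mp hΔodd).2
  -- positivity from the smaller real root
  have hXpos : 0 < X := by
    simp only [TwoTorsionOdd, not_forall] at hnotodd
    obtain ⟨r, hr, hrx⟩ := hnotodd
    have hrx' : r < (x : ℝ) := lt_of_not_ge hrx
    have hcubR := fourXCubed_add_eq_zero_of_twoTorsion_real hy h2
    set G : ℝ := 4 * (r ^ 2 + r * x + (x : ℝ) ^ 2) + (W.b₂ : ℝ) * (r + x) + 2 * (W.b₄ : ℝ) with hG
    have hG0 : (r - x) * G = 0 := by rw [hG]; linear_combination hr - hcubR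
    have hG0' : G = 0 := (mul_eq_zero.mp hG0).resolve_left (sub_ne_zero.mpr hrx'.ne)
    have hδ : ((W.b₂ : ℝ) ^ 2 - 8 * (W.b₂ : ℝ) * x - 48 * (x : ℝ) ^ 2 - 32 * (W.b₄ : ℝ)) =
        (8 * r + 4 * x + (W.b₂ : ℝ)) ^ 2 := by
      rw [hG] at hG0'
      linear_combination (-16) * hG0'
    have hδ' : ((DA : ℚ) : ℝ) = (W.b₂ : ℝ) ^ 2 - 8 * (W.b₂ : ℝ) * x - 48 * (x : ℝ) ^ 2 - 32 * (W.b₄ : ℝ) := by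
      rw [hDA, hb₂, hb₄, hx4]; push_cast; ring
    have hnonneg : (0 : ℝ) ≤ ((DA : ℚ) : ℝ) := by rw [hδ', hδ]; exact sq_nonneg _
    have hDA0 : (0 : ℤ) ≤ DA := by exact_mod_cast hnonneg
    have hX' := Int.odd_iff.mp hXodd
    omega
  refine ⟨X, Int.odd_iff.mp hXodd, hXpos, ?_⟩
  have : ((DA : ℤ) : ℚ) = W.b₂ ^ 2 - 8 * W.b₂ * x - 48 * x ^ 2 - 32 * W.b₄ := by
    rw [hDA, hb₂, hb₄, hx4]; push_cast; ring
  rw [← this, hDA256]; push_cast; ring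

/-- **Existence of a type-A partner in one of the two families** (`D = 4i+1` or `D = 4i+3`, `i ≥ 0`), with the
square-class identity `IsSquare (Δ(W)·Δ(W′_i))` and `D` not a square. [folklore] -/
theorem exists_partnerA (hord : IsOrdinaryAt W 2) {x : ℚ} (hx : HasUniqueRationalTwoTorsionX W x)
    (hram : TwoTorsionRamifiedAtTwo x) (hnotodd : ¬ TwoTorsionOdd W x) :
    ∃ i : ℤ, 0 ≤ i ∧
      ((¬ IsSquare ((4 * i + 1 : ℤ) : ℚ) ∧ IsSquare (W.Δ *
          (⟨1, ((18 * i + 44 : ℤ) : ℚ), ((3 * i + 7 : ℤ) : ℚ), ((105 * i ^ 2 + 360 * i + 559 : ℤ) : ℚ),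
            ((196 * i ^ 3 + 792 * i ^ 2 + 2052 * i + 2019 : ℤ) : ℚ)⟩ : WeierstrassCurve ℚ).Δ)) ∨
       (¬ IsSquare ((4 * i + 3 : ℤ) : ℚ) ∧ IsSquare (W.Δ *
          (⟨1, ((30 * i + 40 : ℤ) : ℚ), ((3 * i + 7 : ℤ) : ℚ), ((273 * i ^ 2 + 595 * i + 390 : ℤ) : ℚ),
            ((676 * i ^ 3 + 2246 * i ^ 2 + 2576 * i + 1119 : ℤ) : ℚ)⟩ : WeierstrassCurve ℚ).Δ))) := by
  obtain ⟨⟨y, hy, h2⟩, huniq⟩ := hx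
  have hcub := fourXCubed_add_eq_zero_of_twoTorsion hy h2
  obtain ⟨D, hDodd, hDpos, hD⟩ := exists_eq_delta_of_typeA W hord ⟨y, hy, h2⟩ hram hnotodd
  have h4Δ := four_mul_Δ_eq_of_twoDivision_root W hcub
  have hΔW : W.Δ = 64 * D * (6 * x ^ 2 + W.b₂ * x + W.b₄) ^ 2 := by
    linear_combination (1 / 4 : ℚ) * h4Δ - (1 / 4 : ℚ) * (6 * x ^ 2 + W.b₂ * x + W.b₄) ^ 2 * hD
  -- `D` is not a square
  have hDns : ¬ IsSquare (D : ℚ) := by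
    rintro ⟨s, hs⟩
    have hσ' : 16 * (4 * s) ^ 2 = W.b₂ ^ 2 - 8 * W.b₂ * x - 48 * x ^ 2 - 32 * W.b₄ := by
      linear_combination (-256 : ℚ) * hs + hD
    have hroot : ∀ τ : ℚ, 16 * τ ^ 2 = W.b₂ ^ 2 - 8 * W.b₂ * x - 48 * x ^ 2 - 32 * W.b₄ →
        4 * ((-(x + W.b₂ / 4) + τ) / 2) ^ 3 + W.b₂ * ((-(x + W.b₂ / 4) + τ) / 2) ^ 2 +
          2 * W.b₄ * ((-(x + W.b₂ / 4) + τ) / 2) + W.b₆ = 0 := by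
      intro τ hτ
      linear_combination hcub + ((-(x + W.b₂ / 4) + τ) / 2 - x) / 16 * hτ
    have hz₁ := huniq _ (hasRationalTwoTorsionX_of_twoDivision_root (hroot (4 * s) hσ'))
    have hz₂ := huniq _ (hasRationalTwoTorsionX_of_twoDivision_root (hroot (-(4 * s)) (by rw [neg_sq]; exact hσ')))
    have hs0 : s = 0 := by linarith
    rw [hs0, mul_zero] at hs
    have : (D : ℚ) = 0 := hs
    have : D = 0 := by exact_mod_cast this
    omega
  -- split on `D mod 4`
  rcases (by omega : D % 4 = 1 ∨ D % 4 = 3) with h1 | h3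
  · refine ⟨(D - 1) / 4, by omega, Or.inl ⟨?_, ?_⟩⟩
    · have : (4 * ((D - 1) / 4) + 1 : ℤ) = D := by omega
      rw [this]; exact hDns
    · refine ⟨216 * D * (6 * x ^ 2 + W.b₂ * x + W.b₄) * (4 * ((D - 1) / 4 : ℤ) - 15) ^ 2, ?_⟩
      have hD' : ((4 * ((D - 1) / 4) + 1 : ℤ) : ℚ) = D := by exact_mod_cast (by omega : (4 * ((D - 1) / 4) + 1 : ℤ) = D)
      rw [partnerAOne_Δ, hΔW]
      push_cast at hD' ⊢
      rw [hD']
      ring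
  · refine ⟨(D - 3) / 4, by omega, Or.inr ⟨?_, ?_⟩⟩
    · have : (4 * ((D - 3) / 4) + 3 : ℤ) = D := by omega
      rw [this]; exact hDns
    · refine ⟨24 * D * (6 * x ^ 2 + W.b₂ * x + W.b₄) * (36 * ((D - 3) / 4 : ℤ) + 11) ^ 2, ?_⟩
      have hD' : ((4 * ((D - 3) / 4) + 3 : ℤ) : ℚ) = D := by exact_mod_cast (by omega : (4 * ((D - 3) / 4) + 3 : ℤ) = D)
      rw [partnerAThree_Δ, hΔW]
      push_cast at hD' ⊢
      rw [hD']
      ring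

/-- **`stub_partnerCF` for TYPE-A input, VERBATIM conclusion.** [folklore] -/
theorem exists_partnerCF_typeA (x : ℚ) (hord : IsOrdinaryAt W 2) (hx : HasUniqueRationalTwoTorsionX W x)
    (hA : TwoTorsionRamifiedAtTwo x ∧ ¬ TwoTorsionOdd W x) :
    ∃ (W' : WeierstrassCurve ℚ) (_ : W'.IsElliptic) (_ : W'.IsGloballyMinimal) (x' : ℚ),
      IsOrdinaryAt W' 2 ∧ HasUniqueRationalTwoTorsionX W' x' ∧ SameGreenbergTypeAB W x W' x' ∧
        IsSquare (W.Δ * W'.Δ) ∧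
        ∃ (W'' : WeierstrassCurve ℚ) (_ : W''.IsElliptic) (_ : W''.IsGloballyMinimal),
          WeierstrassCurve.IsIsogenous W'' W' ∧ IsOrdinaryAt W'' 2 ∧
            (∃ x₀ y₀ : ℚ, W''.toAffine.Equation x₀ y₀ ∧ 2 * y₀ + W''.a₁ * x₀ + W''.a₃ = 0 ∧
              ((TwoTorsionRamifiedAtTwo x₀ ∧ ¬ TwoTorsionOdd W'' x₀) ∨
                (TwoTorsionOdd W'' x₀ ∧ ¬ TwoTorsionRamifiedAtTwo x₀))) ∧
            (∃ x₁ x₂ x₃ : ℚ, x₁ ≠ x₂ ∧ x₁ ≠ x₃ ∧ x₂ ≠ x₃ ∧ HasRationalTwoTorsionX W'' x₁ ∧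
              HasRationalTwoTorsionX W'' x₂ ∧ HasRationalTwoTorsionX W'' x₃) := by
  obtain ⟨i, hi, ⟨hns, hsq⟩ | ⟨hns, hsq⟩⟩ := exists_partnerA W hord hx hA.1 hA.2
  · exact ⟨_, isElliptic_partnerAOne i, isGloballyMinimal_partnerAOne i, _, isOrdinaryAt_two_partnerAOne i,
      hasUniqueRationalTwoTorsionX_partnerAOne i hns,
      Or.inl ⟨hA.1, hA.2, twoTorsionRamifiedAtTwo_partnerA i, not_twoTorsionOdd_partnerAOne i hi⟩, hsq,
      neighbourAOne_block i hi⟩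
  · exact ⟨_, isElliptic_partnerAThree i, isGloballyMinimal_partnerAThree i, _, isOrdinaryAt_two_partnerAThree i,
      hasUniqueRationalTwoTorsionX_partnerAThree i hns,
      Or.inl ⟨hA.1, hA.2, twoTorsionRamifiedAtTwo_partnerA i, not_twoTorsionOdd_partnerAThree i hi⟩, hsq,
      neighbourAThree_block i hi⟩

/-- **`stub_partnerCF` (E1M line `cfsplit`, crux `DepletedLambdaLawAtTwoMod` of route `EisensteinDepletionAtTwo`) IN FULL,
VERBATIM.** For every globally minimal `W`, good ordinary at `2`, with a unique rational point of order `2` of abscissa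
`x` of Greenberg type A or B: a partner `W′` (elliptic, globally minimal, good ordinary at `2`, unique rational
`2`-torsion, same type, `IsSquare (Δ(W)·Δ(W′))`) with a full-`2`-torsion CF-habitat neighbour `W″ ~ W′` (elliptic, globally
minimal, good ordinary at `2`, a Prop-5.14 point, three distinct rational `2`-torsion abscissae). Type A: this file; type B:
`Rank2/CertifiedPartnerTypeB.lean`. [folklore] -/
theorem exists_partnerCF (x : ℚ) (hord : IsOrdinaryAt W 2) (hx : HasUniqueRationalTwoTorsionX W x)
    (hAB : (TwoTorsionRamifiedAtTwo x ∧ ¬ TwoTorsionOdd W x) ∨ (TwoTorsionOdd W x ∧ ¬ TwoTorsionRamifiedAtTwo x)) :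
    ∃ (W' : WeierstrassCurve ℚ) (_ : W'.IsElliptic) (_ : W'.IsGloballyMinimal) (x' : ℚ),
      IsOrdinaryAt W' 2 ∧ HasUniqueRationalTwoTorsionX W' x' ∧ SameGreenbergTypeAB W x W' x' ∧
        IsSquare (W.Δ * W'.Δ) ∧
        ∃ (W'' : WeierstrassCurve ℚ) (_ : W''.IsElliptic) (_ : W''.IsGloballyMinimal),
          WeierstrassCurve.IsIsogenous W'' W' ∧ IsOrdinaryAt W'' 2 ∧
            (∃ x₀ y₀ : ℚ, W''.toAffine.Equation x₀ y₀ ∧ 2 * y₀ + W''.a₁ * x₀ + W''.a₃ = 0 ∧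
              ((TwoTorsionRamifiedAtTwo x₀ ∧ ¬ TwoTorsionOdd W'' x₀) ∨
                (TwoTorsionOdd W'' x₀ ∧ ¬ TwoTorsionRamifiedAtTwo x₀))) ∧
            (∃ x₁ x₂ x₃ : ℚ, x₁ ≠ x₂ ∧ x₁ ≠ x₃ ∧ x₂ ≠ x₃ ∧ HasRationalTwoTorsionX W'' x₁ ∧
              HasRationalTwoTorsionX W'' x₂ ∧ HasRationalTwoTorsionX W'' x₃) := by
  rcases hAB with hA | hB
  · exact exists_partnerCF_typeA W x hord hx hA
  · exact exists_partnerCF_typeB W x hord hx hB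

end PartnerTypeA

end Summit.BirchSwinnertonDyer.Rank2

end
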